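import Literature.AlgebraicGeometry.ShimuraVarieties.KudlaRapoport2013.Sec3IdealLatticesHolds
import HarnessLib

/-!
# [KudlaRapoport2013, Remark 3.3 (arXiv v2 p. 17)] «the fibers of `C(k) ≃ 𝓛_{(1,0)}(k) → 𝓡_{(1,0)}(k)` are the genera,
# i.e. the cosets of `C(k)²`» — DISCHARGED: `KR2013_3_3_holds`

Kernel-lane companion of the statement carpet ★ `…/KudlaRapoport2013/Sec3ComplexUniformization.lean` (squad TKR): its
CLOSED named fact ★ `KR2013_3_3` — S. Kudla, M. Rapoport, *Special cycles on unitary Shimura varieties II: global theory*,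
J. reine angew. Math. 697 (2014) = arXiv:0912.3758v2, §3.2 Remark 3.3 p. 17, typed as: for invertible fractional ideals
`𝔞, 𝔟` of the imaginary-quadratic field `k`, the one-dimensional hermitian spaces `V_{0,𝔞} = (k, N(𝔞)⁻¹ x σ(y))` and `V_{0,𝔟}`
are isometric iff `[𝔞] ∈ [𝔟]·C(k)²` — is PROVED here.  THEOREMS ONLY (no definition, no named fact, no `sorry`, no
instance, no notation); cell hodgecm-mathlib, seat B-typ03 (g34); net debt −1.  HONEST LABEL: HC_CM is proved only modulo
the 7 printed citations (2 remaining named inputs: hLiu418, h413) until rung 0 closes; this file is off that cone.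

## The proof (Gauss's principal genus theorem in Lemmermeyer's norm form; no genus characters, no Hasse principle)

* FORMS (`exists_formCongr_idealGram_iff`): `g = (c) ∈ GL₁(k)` carries `N(𝔟)⁻¹ x σ(y)` to `N(𝔞)⁻¹ x σ(y)` iff
  `σ(c) N(𝔟)⁻¹ c = N(𝔞)⁻¹`, i.e. iff `N_{k/ℚ}(c) · N(𝔞) = N(𝔟)`.  So `V_{0,𝔞} ≅ V_{0,𝔟}` iff `N𝔞 · N𝔟 ∈ N_{k/ℚ}(k^×)`
  (multiply by the norm `N(𝔞)² = N_{k/ℚ}(N𝔞)`).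
* **Satz 90 for ideals** [Lemmermeyer2000, Prop. 2.5] and the **principal genus theorem** [Lemmermeyer2000, Prop. 2.8: «for
  ideals `𝔞, 𝔟` in `𝓞_k`, `N𝔞 = N(λ) N𝔟` for some `λ` iff `𝔞 ∼ 𝔟𝔠²` for some ideal `𝔠`»] (`mk0_mul_mk0_isSquare_iff`): if
  `N(A)·N(B) = N(t)` with (w.l.o.g.) `t ∈ 𝓞_k`, put `E = A·B` (times a principal ideal clearing the denominator of `t`), so that
  `E·σ(E) = (N E) = (t σ(t))`; the INTEGRAL IDEAL `T := (t) + E` then satisfies `E · σ(T) = E σ(t) + E σ(E) = (σ t)·((t) + E) =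
  (σ t)·T` — Lemmermeyer's `𝔠 = 1 + 𝔢` for `𝔢 = E/(t)` of norm `1` — whence `[E] = [T][σT]⁻¹ = [T]²` because `T·σ(T) = (N T)` is
  principal; conversely `[A][B] = [T]²` gives `(x)AB = (y)T²`, so `N(A)N(B) = N(y·N(T)/x)`.
* TRANSPORT (`KR2013_3_3_holds`): every class has an integral representative (Mathlib `ClassGroup.mk0_surjective`), and
  `𝔞 = γ·A` changes `N𝔞` by the norm `N(γ) > 0` (★ `classGroup_mk_eq_mk_iff_exists`, `FractionalIdeal.absNorm_span_singleton`).
The quadratic-field inputs are ★ `KR14dual.mul_map_conj_eq_span_absNorm` (`J·σ(J) = (N J)`) and ★ `KR14dual.mul_conj_eq_norm`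
(`x σ(x) = N(x)`) of ★ `Sec14TraceDualHolds` (B-typ01 (g32)).

## References
* [KudlaRapoport2013] S. Kudla, M. Rapoport, *Special cycles on unitary Shimura varieties II: global theory*, J. reine
  angew. Math. 697 (2014) 91–157; arXiv:0912.3758v2, §3.2 Remark 3.3 (p. 17).
* [Lemmermeyer2000] F. Lemmermeyer, *Reciprocity Laws. From Euler to Eisenstein*, Springer (2000), Ch. 2 §2.1 Prop. 2.5
  (Hilbert's Satz 90 for ideals: `N𝔞 = 1 ⇒ 𝔞 = 𝔟^{1−σ}`), §2.2 Prop. 2.8 (the principal genus consists of the squares).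
* [NeukirchANT1999] J. Neukirch, *Algebraic Number Theory*, Ch. I §2 Prop. (2.6) (`𝔞 σ(𝔞) = (N𝔞)`), Ch. I §6 (class group).
-/

set_option autoImplicit false

noncomputable section

open NumberField Matrix
open scoped nonZeroDivisors

namespace Literature.AlgebraicGeometry.ShimuraVarieties.KudlaRapoport2013.Sec3ComplexUniformization

open Literature.NumberTheory.Automorphic (formCongr)
open Literature.NumberTheory.Automorphic.Liu2021.AppendixC (conj conj_apply)
open Literature.AlgebraicGeometry.ShimuraVarieties.KudlaRapoport2013.Sec14CaseNTwo

variable {k : Type} [Field k] [NumberField k] [IsTotallyComplex k] [Algebra.IsQuadraticExtension ℚ k]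

/-! ### §1 Norms in the imaginary-quadratic field `k` -/

/-- `τ(σ x) = conj(τ x)` for every complex embedding `τ`. [folklore] -/
private theorem embedding_conj' (τ : k →+* ℂ) (x : k) : τ (conj ℚ k x) = starRingEnd ℂ (τ x) := by
  letI : IsCMField k := IsCMField.ofCMExtension ℚ k
  rw [conj_apply]
  exact IsCMField.complexEmbedding_complexConj (K := k) τ x

omit [IsTotallyComplex k] [Algebra.IsQuadraticExtension ℚ k] in
/-- `τ(q) = q` for rationals. [folklore] -/
private theorem embedding_algebraMap' (τ : k →+* ℂ) (q : ℚ) : τ (algebraMap ℚ k q) = (q : ℂ) := by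
  rw [eq_ratCast (algebraMap ℚ k), map_ratCast]

/-- **`N_{k/ℚ}(c) > 0` for `c ≠ 0`** (`k` imaginary quadratic): `τ(N c) = τ(c σ c) = |τ c|²`. [folklore] -/
private theorem norm_pos {c : k} (hc : c ≠ 0) : 0 < Algebra.norm ℚ c := by
  obtain ⟨τ⟩ := (inferInstance : Nonempty (k →+* ℂ))
  have h := congrArg τ (KR14dual.mul_conj_eq_norm c)
  rw [map_mul, embedding_conj', embedding_algebraMap', Complex.mul_conj] at h
  have hpos : (0 : ℝ) < Complex.normSq (τ c) := Complex.normSq_pos.2 ((map_ne_zero τ).2 hc)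
  have h' : (Complex.normSq (τ c) : ℝ) = ((Algebra.norm ℚ c : ℚ) : ℝ) := by exact_mod_cast h
  exact_mod_cast (h' ▸ hpos)

/-- `|N_{k/ℚ}(c)| = N_{k/ℚ}(c)`. [folklore] -/
private theorem abs_norm (c : k) : |Algebra.norm ℚ c| = Algebra.norm ℚ c := by
  by_cases hc : c = 0
  · rw [hc, Algebra.norm_zero, abs_zero]
  · exact abs_of_pos (norm_pos hc)

omit [IsTotallyComplex k] in
/-- `N_{k/ℚ}(q) = q²` for `q ∈ ℚ`. [folklore] -/
private theorem norm_algebraMap_rat (q : ℚ) : Algebra.norm ℚ (algebraMap ℚ k q) = q ^ 2 := by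
  rw [Algebra.norm_algebraMap, Algebra.IsQuadraticExtension.finrank_eq_two ℚ k]

/-- `(N_{k/ℚ} x : ℚ) = N(x)` and `N((x)) = N_{k/ℚ}(x)` for an algebraic integer `x`: `(absNorm (x) : ℚ) = N_{k/ℚ}(x)`. [folklore] -/
private theorem absNorm_span_singleton_cast (x : 𝓞 k) :
    ((Ideal.absNorm (Ideal.span {x}) : ℕ) : ℚ) = Algebra.norm ℚ (x : k) := by
  rw [Ideal.absNorm_span_singleton, ← Algebra.coe_norm_int, ← Int.cast_natCast, Int.natCast_natAbs,
    abs_of_nonneg]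
  have h := abs_norm (x : k)
  rw [← Algebra.coe_norm_int] at h
  exact_mod_cast (abs_nonneg _).trans_eq h

/-- `x · σ(x) = N((x))` in `𝓞_k`, for any `σ' : 𝓞_k → 𝓞_k` lifting `σ`. [cite: NeukirchANT1999, Ch. I §2 Prop. (2.6) (ii)] -/
private theorem mul_map_eq_absNorm (σ' : 𝓞 k →+* 𝓞 k) (hσ' : ∀ x : 𝓞 k, ((σ' x : 𝓞 k) : k) = conj ℚ k x)
    (x : 𝓞 k) : x * σ' x = ((Ideal.absNorm (Ideal.span {x}) : ℕ) : 𝓞 k) := by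
  apply FaithfulSMul.algebraMap_injective (𝓞 k) k
  rw [map_mul, map_natCast]
  change (x : k) * ((σ' x : 𝓞 k) : k) = _
  rw [hσ', KR14dual.mul_conj_eq_norm, ← absNorm_span_singleton_cast, map_natCast]

/-! ### §2 Satz 90 for ideals and the principal genus theorem [Lemmermeyer2000, Prop. 2.5, Prop. 2.8] -/

omit [NumberField k] [IsTotallyComplex k] [Algebra.IsQuadraticExtension ℚ k] in
/-- **The `1 + 𝔢` identity of Satz 90 for ideals** [Lemmermeyer2000, Prop. 2.5, proof]: if `E·σ(E) = (t)·(σ t)` (i.e. `𝔢 = E/(t)`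
has norm `1`) then `T = (t) + E` satisfies `E · σ(T) = (σ t) · T` (i.e. `𝔢 · σ(𝔠) = 𝔠` for `𝔠 = 1 + 𝔢 = T/(t)`).
[cite: Lemmermeyer2000, Ch. 2 §2.1 Prop. 2.5] -/
theorem mul_map_span_sup_eq (σ' : 𝓞 k →+* 𝓞 k) (E : Ideal (𝓞 k)) (t : 𝓞 k)
    (hE : E * E.map σ' = Ideal.span {t} * Ideal.span {σ' t}) :
    E * (Ideal.span {t} ⊔ E).map σ' = Ideal.span {σ' t} * (Ideal.span {t} ⊔ E) := by
  rw [Ideal.map_sup, Ideal.map_span, Set.image_singleton, Ideal.mul_sup, hE, Ideal.mul_sup,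
    mul_comm E (Ideal.span {σ' t}), mul_comm (Ideal.span {t}) (Ideal.span {σ' t}), sup_comm]

omit [IsTotallyComplex k] [Algebra.IsQuadraticExtension ℚ k] in
/-- **[σ(T)] = [T]⁻¹** in `C(k)`: `T · σ(T) = (N T)` is principal. [cite: NeukirchANT1999, Ch. I §2 Prop. (2.6) (iii)] -/
theorem mk0_map_eq_inv (σ' : 𝓞 k →+* 𝓞 k)
    (hmul : ∀ J : Ideal (𝓞 k), J * J.map σ' = Ideal.span {((Ideal.absNorm J : ℕ) : 𝓞 k)})
    (T : Ideal (𝓞 k)) (hT : T ≠ ⊥) (hσT : T.map σ' ≠ ⊥) :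
    ClassGroup.mk0 ⟨T.map σ', mem_nonZeroDivisors_iff_ne_zero.2 hσT⟩ =
      (ClassGroup.mk0 ⟨T, mem_nonZeroDivisors_iff_ne_zero.2 hT⟩)⁻¹ := by
  rw [ClassGroup.mk0_eq_mk0_inv_iff]
  refine ⟨((Ideal.absNorm T : ℕ) : 𝓞 k), ?_, ?_⟩
  · exact_mod_cast (Ideal.absNorm_eq_zero_iff.not.2 hT)
  · change T.map σ' * T = _
    rw [mul_comm, hmul]

omit [IsTotallyComplex k] [Algebra.IsQuadraticExtension ℚ k] in
/-- Principal factors are invisible in `C(k)`: `[(x) · J] = [J]`. [folklore] -/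
private theorem mk0_span_singleton_mul (x : 𝓞 k) (hx : x ≠ 0) (J : Ideal (𝓞 k)) (hJ : J ≠ ⊥)
    (hxJ : Ideal.span {x} * J ≠ ⊥) :
    ClassGroup.mk0 ⟨Ideal.span {x} * J, mem_nonZeroDivisors_iff_ne_zero.2 hxJ⟩ =
      ClassGroup.mk0 ⟨J, mem_nonZeroDivisors_iff_ne_zero.2 hJ⟩ := by
  rw [ClassGroup.mk0_eq_mk0_iff]
  exact ⟨1, x, one_ne_zero, hx, by rw [Ideal.span_singleton_one, Ideal.top_mul]⟩


/-- `σ'` is injective (it lifts the automorphism `σ`). [folklore] -/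
private theorem map_ne_zero_of_lift (σ' : 𝓞 k →+* 𝓞 k) (hσ' : ∀ x : 𝓞 k, ((σ' x : 𝓞 k) : k) = conj ℚ k x)
    {x : 𝓞 k} (hx : x ≠ 0) : σ' x ≠ 0 := by
  intro h
  have h' : conj ℚ k (x : k) = 0 := by rw [← hσ', h]; rfl
  exact hx (RingOfIntegers.coe_eq_zero_iff.1 ((map_eq_zero_iff _ (conj ℚ k).injective).1 h'))

/-- **The principal genus theorem, class form** [Lemmermeyer2000, Prop. 2.8 «for ideals `𝔞, 𝔟` in `𝓞_k` we have `N𝔞 = N(λ)N𝔟`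
for some `λ` iff `𝔞 ∼ 𝔟𝔠²` for some ideal `𝔠`»], here for the (ordinary) class group of the imaginary-quadratic `k` (every
`λ ≠ 0` is «totally positive») and in the symmetric normalisation: for non-zero ideals `A, B` of `𝓞_k`, `[A]·[B]` is a square
in `C(k)` iff `N(A)·N(B)` is a norm from `k^×`.  (⇒) `(x)AB = (y)T²` gives `N(A)N(B) = N(y·N(T)/x)`.  (⇐) Satz 90 for ideals
[Lemmermeyer2000, Prop. 2.5]: with `N(t) = N(E)`, `E = (b)·A·B`, `t ∈ 𝓞_k`, the ideal `T = (t) + E` has `E·σ(T) = (σ t)·T`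
(`mul_map_span_sup_eq`), so `[E] = [T]·[σT]⁻¹ = [T]²` (`mk0_map_eq_inv`).  Stated for any lift `σ'` of `σ` to `𝓞_k` with
`J·σ'(J) = (N J)`. [cite: Lemmermeyer2000, Ch. 2 §2.2 Prop. 2.8; §2.1 Prop. 2.5] -/
theorem mk0_mul_mk0_isSquare_iff (σ' : 𝓞 k →+* 𝓞 k) (hσ' : ∀ x : 𝓞 k, ((σ' x : 𝓞 k) : k) = conj ℚ k x)
    (hmul : ∀ J : Ideal (𝓞 k), J * J.map σ' = Ideal.span {((Ideal.absNorm J : ℕ) : 𝓞 k)})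
    (A B : Ideal (𝓞 k)) (hA : A ≠ ⊥) (hB : B ≠ ⊥) :
    (∃ T : (Ideal (𝓞 k))⁰, ClassGroup.mk0 ⟨A, mem_nonZeroDivisors_iff_ne_zero.2 hA⟩ *
        ClassGroup.mk0 ⟨B, mem_nonZeroDivisors_iff_ne_zero.2 hB⟩ = ClassGroup.mk0 T ^ 2) ↔
      ∃ t : k, t ≠ 0 ∧ Algebra.norm ℚ t = (Ideal.absNorm A : ℚ) * Ideal.absNorm B := by
  classical
  constructor
  · rintro ⟨T, hT⟩
    have hT0 : (T : Ideal (𝓞 k)) ≠ ⊥ := mem_nonZeroDivisors_iff_ne_zero.1 T.2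
    rw [← map_mul, pow_two, ← map_mul, ClassGroup.mk0_eq_mk0_iff] at hT
    obtain ⟨x, y, hx, hy, hxy⟩ := hT
    change Ideal.span {x} * (A * B) = Ideal.span {y} * ((T : Ideal (𝓞 k)) * T) at hxy
    have hN := congrArg (fun I : Ideal (𝓞 k) => ((Ideal.absNorm I : ℕ) : ℚ)) hxy
    simp only [map_mul, Nat.cast_mul, absNorm_span_singleton_cast] at hN
    have hx' : (x : k) ≠ 0 := RingOfIntegers.coe_ne_zero_iff.2 hx
    have hy' : (y : k) ≠ 0 := RingOfIntegers.coe_ne_zero_iff.2 hy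
    have hNx : Algebra.norm ℚ (x : k) ≠ 0 := (norm_pos hx').ne'
    have hNT : ((Ideal.absNorm (T : Ideal (𝓞 k)) : ℕ) : ℚ) ≠ 0 := by exact_mod_cast Ideal.absNorm_eq_zero_iff.not.2 hT0
    refine ⟨(y : k) * algebraMap ℚ k (Ideal.absNorm (T : Ideal (𝓞 k)) : ℚ) * (x : k)⁻¹,
      mul_ne_zero (mul_ne_zero hy' ((map_ne_zero_iff _ (algebraMap ℚ k).injective).2 hNT)) (inv_ne_zero hx'), ?_⟩
    rw [map_mul, map_mul, Algebra.norm_inv, norm_algebraMap_rat]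
    field_simp
    linear_combination hN.symm
  · rintro ⟨t, ht0, ht⟩
    -- clear the denominator of `t`: `t' = b t ∈ 𝓞_k`
    obtain ⟨b, hb⟩ := IsLocalization.exists_integer_multiple (𝓞 k)⁰ t
    obtain ⟨t', ht'⟩ : ∃ t' : 𝓞 k, algebraMap (𝓞 k) k t' = ((b : 𝓞 k) : 𝓞 k) • t := hb
    rw [Algebra.smul_def] at ht'
    have hb0 : (b : 𝓞 k) ≠ 0 := mem_nonZeroDivisors_iff_ne_zero.1 b.2
    have hAB : A * B ≠ ⊥ := fun h => (Ideal.mul_eq_bot.1 h).elim hA hB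
    have hE0 : Ideal.span {(b : 𝓞 k)} * (A * B) ≠ ⊥ := fun h =>
      (Ideal.mul_eq_bot.1 h).elim (fun h' => hb0 (Ideal.span_singleton_eq_bot.1 h')) hAB
    set E : Ideal (𝓞 k) := Ideal.span {(b : 𝓞 k)} * (A * B) with hE
    -- `N(t') = N(E)`
    have hNt' : Algebra.norm ℚ (t' : k) = ((Ideal.absNorm E : ℕ) : ℚ) := by
      change Algebra.norm ℚ (algebraMap (𝓞 k) k t') = _
      rw [ht', map_mul, ht, hE, map_mul, map_mul, Nat.cast_mul, Nat.cast_mul, absNorm_span_singleton_cast]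
    have ht'0 : t' ≠ 0 := by
      intro h
      rw [h, show ((0 : 𝓞 k) : k) = 0 from rfl, Algebra.norm_zero] at hNt'
      exact Ideal.absNorm_eq_zero_iff.not.2 hE0 (by exact_mod_cast hNt'.symm)
    have hspan : Ideal.absNorm (Ideal.span {t'}) = Ideal.absNorm E := by
      have h := (absNorm_span_singleton_cast t').trans hNt'
      exact_mod_cast h
    -- Satz 90 for ideals: `E σ(E) = (t')(σ t')`, `T = (t') + E`, `E σ(T) = (σ t') T`
    have hEE : E * E.map σ' = Ideal.span {t'} * Ideal.span {σ' t'} := by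
      rw [hmul, Ideal.span_singleton_mul_span_singleton, mul_map_eq_absNorm σ' hσ' t', hspan]
    have key := mul_map_span_sup_eq σ' E t' hEE
    have hT0 : Ideal.span {t'} ⊔ E ≠ ⊥ := fun h => hE0 (le_bot_iff.1 (h ▸ le_sup_right))
    have hσt' : σ' t' ≠ 0 := map_ne_zero_of_lift σ' hσ' ht'0
    have hσT0 : (Ideal.span {t'} ⊔ E).map σ' ≠ ⊥ := fun h => by
      rw [Ideal.map_sup, Ideal.map_span, Set.image_singleton] at h
      exact hσt' (Ideal.span_singleton_eq_bot.1 (le_bot_iff.1 (h ▸ le_sup_left)))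
    have hσtT : Ideal.span {σ' t'} * (Ideal.span {t'} ⊔ E) ≠ ⊥ := fun h =>
      (Ideal.mul_eq_bot.1 h).elim (fun h' => hσt' (Ideal.span_singleton_eq_bot.1 h')) hT0
    -- classes: `[E]·[σT] = [(σ t') T] = [T]`, `[σT] = [T]⁻¹`
    have hcl : ClassGroup.mk0 ⟨E, mem_nonZeroDivisors_iff_ne_zero.2 hE0⟩ *
        ClassGroup.mk0 ⟨(Ideal.span {t'} ⊔ E).map σ', mem_nonZeroDivisors_iff_ne_zero.2 hσT0⟩ =
          ClassGroup.mk0 ⟨Ideal.span {t'} ⊔ E, mem_nonZeroDivisors_iff_ne_zero.2 hT0⟩ := by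
      have hprod : (⟨E, mem_nonZeroDivisors_iff_ne_zero.2 hE0⟩ *
          ⟨(Ideal.span {t'} ⊔ E).map σ', mem_nonZeroDivisors_iff_ne_zero.2 hσT0⟩ : (Ideal (𝓞 k))⁰) =
            ⟨Ideal.span {σ' t'} * (Ideal.span {t'} ⊔ E), mem_nonZeroDivisors_iff_ne_zero.2 hσtT⟩ :=
        Subtype.ext key
      rw [← map_mul, hprod, mk0_span_singleton_mul (σ' t') hσt' _ hT0 hσtT]
    rw [mk0_map_eq_inv σ' hmul _ hT0 hσT0, mul_inv_eq_iff_eq_mul] at hcl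
    -- `[E] = [A]·[B]`
    have hEAB : ClassGroup.mk0 ⟨E, mem_nonZeroDivisors_iff_ne_zero.2 hE0⟩ =
        ClassGroup.mk0 ⟨A, mem_nonZeroDivisors_iff_ne_zero.2 hA⟩ *
          ClassGroup.mk0 ⟨B, mem_nonZeroDivisors_iff_ne_zero.2 hB⟩ := by
      rw [← map_mul]
      exact mk0_span_singleton_mul (b : 𝓞 k) hb0 (A * B) hAB hE0
    refine ⟨⟨Ideal.span {t'} ⊔ E, mem_nonZeroDivisors_iff_ne_zero.2 hT0⟩, ?_⟩
    rw [← hEAB, hcl, pow_two]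


/-! ### §3 The forms `N(𝔞)⁻¹ x σ(y)`: `V_{0,𝔞} ≅ V_{0,𝔟} ⟺ N(c)·N(𝔞) = N(𝔟)` for some `c ∈ k^×` -/

/-- `(A B)₀₀ = A₀₀ B₀₀` for `1 × 1` matrices. [folklore] -/
private theorem mul_fin_one_apply' {R : Type*} [NonUnitalNonAssocSemiring R] (A B : Matrix (Fin 1) (Fin 1) R) :
    (A * B) 0 0 = A 0 0 * B 0 0 := by
  simp [Matrix.mul_apply]

omit [NumberField k] [IsTotallyComplex k] [Algebra.IsQuadraticExtension ℚ k] in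
/-- The `(0,0)` entry of `σ(g)ᵀ H g` in rank one. [folklore] -/
private theorem formCongr_fin_one_apply' (σ : k →+* k) (g : GL (Fin 1) k) (H : Matrix (Fin 1) (Fin 1) k) :
    formCongr σ g H 0 0 = σ ((g : Matrix (Fin 1) (Fin 1) k) 0 0) * H 0 0 * (g : Matrix (Fin 1) (Fin 1) k) 0 0 := by
  dsimp only [formCongr]
  rw [mul_fin_one_apply', mul_fin_one_apply', Matrix.transpose_apply, Matrix.map_apply]

omit [IsTotallyComplex k] [Algebra.IsQuadraticExtension ℚ k] in
/-- `N(𝔞) ≠ 0` for an invertible fractional ideal. [folklore] -/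
private theorem absNorm_ne_zero (𝔞 : (FractionalIdeal (𝓞 k)⁰ k)ˣ) :
    FractionalIdeal.absNorm (𝔞 : FractionalIdeal (𝓞 k)⁰ k) ≠ 0 :=
  fun h => Units.ne_zero 𝔞 (FractionalIdeal.absNorm_eq_zero_iff.mp h)

/-- **`V_{0,𝔞} ≅ V_{0,𝔟}` iff `N_{k/ℚ}(c)·N(𝔞) = N(𝔟)` for some `c ∈ k^×`**: an isometry `g = (c) ∈ GL₁(k)` from
`(x,y) = N(𝔟)⁻¹ x σ(y)` to `N(𝔞)⁻¹ x σ(y)` means `σ(c) N(𝔟)⁻¹ c = N(𝔞)⁻¹`, and `c σ(c) = N(c)`. [cite: KudlaRapoport2013, §3.2 Rem. 3.3 (arXiv v2 p. 17)] -/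
theorem exists_formCongr_idealGram_iff (𝔞 𝔟 : (FractionalIdeal (𝓞 k)⁰ k)ˣ) :
    (∃ g : GL (Fin 1) k, formCongr (conj ℚ k : k →+* k) g (idealGram 𝔟) = idealGram 𝔞) ↔
      ∃ c : k, c ≠ 0 ∧ Algebra.norm ℚ c * FractionalIdeal.absNorm (𝔞 : FractionalIdeal (𝓞 k)⁰ k) =
        FractionalIdeal.absNorm (𝔟 : FractionalIdeal (𝓞 k)⁰ k) := by
  have hN𝔞 := absNorm_ne_zero 𝔞
  have hN𝔟 := absNorm_ne_zero 𝔟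
  constructor
  · rintro ⟨g, hg⟩
    set c : k := (g : Matrix (Fin 1) (Fin 1) k) 0 0 with hc
    have hc0 : c ≠ 0 := by
      have h1 := congrFun (congrFun (Units.inv_mul g) 0) 0
      rw [mul_fin_one_apply', Matrix.one_apply_eq] at h1
      exact right_ne_zero_of_mul_eq_one h1
    have h := congrFun (congrFun hg 0) 0
    rw [formCongr_fin_one_apply', idealGram, idealGram, Matrix.of_apply, Matrix.of_apply, ← hc] at h
    change conj ℚ k c * algebraMap ℚ k (FractionalIdeal.absNorm (𝔟 : FractionalIdeal (𝓞 k)⁰ k))⁻¹ * c =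
      algebraMap ℚ k (FractionalIdeal.absNorm (𝔞 : FractionalIdeal (𝓞 k)⁰ k))⁻¹ at h
    have h2 : c * conj ℚ k c * algebraMap ℚ k (FractionalIdeal.absNorm (𝔟 : FractionalIdeal (𝓞 k)⁰ k))⁻¹ =
        algebraMap ℚ k (FractionalIdeal.absNorm (𝔞 : FractionalIdeal (𝓞 k)⁰ k))⁻¹ := by
      rw [← h]
      ring
    rw [KR14dual.mul_conj_eq_norm, ← map_mul] at h2
    have h' := (algebraMap ℚ k).injective h2
    refine ⟨c, hc0, ?_⟩
    field_simp at h'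
    linear_combination h'
  · rintro ⟨c, hc0, hc⟩
    refine ⟨Matrix.GeneralLinearGroup.mkOfDetNeZero !![c] (by rw [Matrix.det_fin_one_of]; exact hc0), ?_⟩
    ext i j
    rw [Subsingleton.elim i 0, Subsingleton.elim j 0, formCongr_fin_one_apply', idealGram, idealGram, Matrix.of_apply,
      Matrix.of_apply]
    change conj ℚ k c * algebraMap ℚ k (FractionalIdeal.absNorm (𝔟 : FractionalIdeal (𝓞 k)⁰ k))⁻¹ * c =
      algebraMap ℚ k (FractionalIdeal.absNorm (𝔞 : FractionalIdeal (𝓞 k)⁰ k))⁻¹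
    calc conj ℚ k c * algebraMap ℚ k (FractionalIdeal.absNorm (𝔟 : FractionalIdeal (𝓞 k)⁰ k))⁻¹ * c
        = c * conj ℚ k c * algebraMap ℚ k (FractionalIdeal.absNorm (𝔟 : FractionalIdeal (𝓞 k)⁰ k))⁻¹ := by ring
      _ = algebraMap ℚ k (Algebra.norm ℚ c * (FractionalIdeal.absNorm (𝔟 : FractionalIdeal (𝓞 k)⁰ k))⁻¹) := by
          rw [KR14dual.mul_conj_eq_norm, ← map_mul]
      _ = algebraMap ℚ k (FractionalIdeal.absNorm (𝔞 : FractionalIdeal (𝓞 k)⁰ k))⁻¹ := by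
          congr 1
          rw [← hc, mul_inv, mul_inv_cancel_left₀ (norm_pos hc0).ne']

/-! ### §4 Integral representatives and assembly -/

/-- Every class of invertible fractional ideals has an integral representative `A`, and then `N(𝔞) = N(γ)·N(A)` with
`𝔞 = γ A`, `γ ∈ k^×` (Mathlib `ClassGroup.mk0_surjective` + ★ `classGroup_mk_eq_mk_iff_exists`; the norm of a principal
fractional ideal is `|N(γ)| = N(γ)` in the imaginary-quadratic `k`). [cite: NeukirchANT1999, Ch. I §6 (the ideal class group `J_k/P_k`; every class contains an integral ideal)] -/
theorem exists_integral_rep (𝔞 : (FractionalIdeal (𝓞 k)⁰ k)ˣ) :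
    ∃ (A : Ideal (𝓞 k)) (hA : A ≠ ⊥) (γ : k), γ ≠ 0 ∧
      ClassGroup.mk k 𝔞 = ClassGroup.mk0 ⟨A, mem_nonZeroDivisors_iff_ne_zero.2 hA⟩ ∧
      FractionalIdeal.absNorm (𝔞 : FractionalIdeal (𝓞 k)⁰ k) = Algebra.norm ℚ γ * Ideal.absNorm A := by
  obtain ⟨A', hA'⟩ := ClassGroup.mk0_surjective (ClassGroup.mk k 𝔞)
  have hA : (A' : Ideal (𝓞 k)) ≠ ⊥ := mem_nonZeroDivisors_iff_ne_zero.1 A'.2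
  have hmk : ClassGroup.mk k (FractionalIdeal.mk0 k A') = ClassGroup.mk k 𝔞 := by rw [ClassGroup.mk_mk0, hA']
  obtain ⟨γ, hγ⟩ := (classGroup_mk_eq_mk_iff_exists (FractionalIdeal.mk0 k A') 𝔞).1 hmk
  rw [FractionalIdeal.coe_mk0] at hγ
  have hγ0 : γ ≠ 0 := by
    rintro rfl
    rw [FractionalIdeal.spanSingleton_zero, zero_mul] at hγ
    exact Units.ne_zero 𝔞 hγ
  refine ⟨A', hA, γ, hγ0, hA'.symm, ?_⟩
  rw [hγ, map_mul, FractionalIdeal.absNorm_span_singleton, FractionalIdeal.coeIdeal_absNorm, abs_norm]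

omit [IsTotallyComplex k] [Algebra.IsQuadraticExtension ℚ k] in
/-- Group bookkeeping in `C(k)`: `X ∈ Y·C(k)²` iff `X·Y` is a square of an integral class. [folklore] -/
private theorem exists_sq_iff_mul_isSquare (X Y : ClassGroup (𝓞 k)) :
    (∃ C : ClassGroup (𝓞 k), X = Y * C ^ 2) ↔ ∃ T : (Ideal (𝓞 k))⁰, X * Y = ClassGroup.mk0 T ^ 2 := by
  constructor
  · rintro ⟨C, hC⟩
    obtain ⟨T, hT⟩ := ClassGroup.mk0_surjective (Y * C)
    refine ⟨T, ?_⟩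
    rw [hT, hC, mul_pow, pow_two, pow_two]
    ac_rfl
  · rintro ⟨T, hT⟩
    refine ⟨ClassGroup.mk0 T / Y, ?_⟩
    rw [div_pow, ← mul_div_assoc, eq_div_iff_mul_eq', ← hT, pow_two]
    ac_rfl

/-- ★ `KR2013_3_3` HOLDS. [KudlaRapoport2013, §3.2 Remark 3.3 (arXiv v2 p. 17)]: «the fibers of the map
`C(k) ≃ 𝓛_{(1,0)}(k) → 𝓡_{(1,0)}(k)` are the genera, i.e., the cosets of the subgroup `C(k)²`» — `V_{0,𝔞} ≅ V_{0,𝔟}` iff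
`[𝔞] ∈ [𝔟]·C(k)²`: the forms side is `N(𝔞)N(𝔟) ∈ N_{k/ℚ}(k^×)` (`exists_formCongr_idealGram_iff`), the class side is the
principal genus theorem `mk0_mul_mk0_isSquare_iff` [Lemmermeyer2000, Prop. 2.8] on integral representatives.
[cite: KudlaRapoport2013, §3.2 Rem. 3.3 (arXiv v2 p. 17)] [cite: Lemmermeyer2000, Ch. 2 §2.2 Prop. 2.8; §2.1 Prop. 2.5] -/
theorem KR2013_3_3_holds : KR2013_3_3 := by
  intro k _ _ _ _ 𝔞 𝔟
  classical
  have hσ' : ∀ x : 𝓞 k, ((RingOfIntegers.mapRingHom (((conj ℚ k : k ≃ₐ[ℚ] k) : k →ₐ[ℚ] k) : k →+* k) x : 𝓞 k) : k) =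
      conj ℚ k x := fun x => rfl
  obtain ⟨A, hA, γ, hγ0, h𝔞A, hN𝔞⟩ := exists_integral_rep 𝔞
  obtain ⟨B, hB, δ, hδ0, h𝔟B, hN𝔟⟩ := exists_integral_rep 𝔟
  have hNγ : Algebra.norm ℚ γ ≠ 0 := (norm_pos hγ0).ne'
  have hNδ : Algebra.norm ℚ δ ≠ 0 := (norm_pos hδ0).ne'
  have hNA : ((Ideal.absNorm A : ℕ) : ℚ) ≠ 0 := by exact_mod_cast Ideal.absNorm_eq_zero_iff.not.2 hA
  have hNAk : algebraMap ℚ k (Ideal.absNorm A : ℚ) ≠ 0 := (map_ne_zero_iff _ (algebraMap ℚ k).injective).2 hNA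
  rw [exists_formCongr_idealGram_iff, h𝔞A, h𝔟B, exists_sq_iff_mul_isSquare,
    mk0_mul_mk0_isSquare_iff _ hσ' KR14dual.mul_map_conj_eq_span_absNorm A B hA hB, hN𝔞, hN𝔟]
  constructor
  · rintro ⟨c, hc0, hc⟩
    refine ⟨c * γ * algebraMap ℚ k (Ideal.absNorm A : ℚ) * δ⁻¹,
      mul_ne_zero (mul_ne_zero (mul_ne_zero hc0 hγ0) hNAk) (inv_ne_zero hδ0), ?_⟩
    rw [map_mul, map_mul, map_mul, Algebra.norm_inv, norm_algebraMap_rat]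
    field_simp
    linear_combination hc
  · rintro ⟨t, ht0, ht⟩
    refine ⟨t * δ * (γ * algebraMap ℚ k (Ideal.absNorm A : ℚ))⁻¹,
      mul_ne_zero (mul_ne_zero ht0 hδ0) (inv_ne_zero (mul_ne_zero hγ0 hNAk)), ?_⟩
    rw [map_mul, map_mul, Algebra.norm_inv, map_mul, norm_algebraMap_rat]
    field_simp
    linear_combination ht

end Literature.AlgebraicGeometry.ShimuraVarieties.KudlaRapoport2013.Sec3ComplexUniformization

end
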